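import Summits.KontsevichZagierPeriods.KontsevichZagierPeriods.Theorems.SymplecticScissorsVolumeFormOffPlaneLogBoxValue
import Summits.KontsevichZagierPeriods.KontsevichZagierPeriods.Theorems.SymplecticScissorsVolumeFormOffPlaneLogBoxCut
import Summits.KontsevichZagierPeriods.KontsevichZagierPeriods.Theorems.SymplecticScissorsVolumeFormOffPlaneRankTwoLogRatio
import Summits.KontsevichZagierPeriods.KontsevichZagierPeriods.Theorems.SymplecticScissorsVolumeFormOffPlaneLogBoxLinear
import Summits.KontsevichZagierPeriods.KontsevichZagierPeriods.Theorems.SymplecticScissorsVolumeFormOffPlaneToricG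
import Summits.KontsevichZagierPeriods.KontsevichZagierPeriods.Theorems.SymplecticScissorsVolumeFormOffPlaneToricH
import Summits.KontsevichZagierPeriods.KontsevichZagierPeriods.Theorems.SymplecticScissorsVolumeFormOffPlaneToricE
import Summits.KontsevichZagierPeriods.KontsevichZagierPeriods.Theorems.SymplecticScissorsVolumeFormOffPlaneScissors
import Summits.KontsevichZagierPeriods.KontsevichZagierPeriods.Theorems.SymplecticScissorsVolumeFormOffPlaneWeightedOfFamilies
import Summits.KontsevichZagierPeriods.KontsevichZagierPeriods.Theorems.SymplecticScissorsVolumeFormOffPlanePairsOfDecomposition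
import Summits.KontsevichZagierPeriods.KontsevichZagierPeriods.Theorems.SymplecticScissorsVolumeFormOffPlaneTorsionClosure
import Summits.KontsevichZagierPeriods.KontsevichZagierPeriods.Theorems.SymplecticScissorsVolumeFormOffPlaneBinomialCertificate

/-!
# `VolumeFormOffPlane` (stmt-KontsevichZagierPeriods-14935) — line `Sketch`:
CERTIFIED PAIRS, the rank-two toric sector from signed decompositions (every dimension)

The user-facing form of the line's v6 "signed scissors" layer. Fix multiplicatively independent
positive real algebraic numbers `α`, `β` and let `Λ = ℚ log α ⊕ ℚ log β`.

* `weightedBoxes` — `ℤ`-weighted families of integrand-`1` representations on Λ-boxes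
  `{a_j < x_j < a_j·α^{u_j}β^{v_j}} × {0 < z, z·∏x < 1}` (real-algebraic position, edge ratios in
  `α^ℚ β^ℚ`) with total weighted value `0` are relations (landed box sector
  `rankTwoToricBoxesPosition` = helpers ToricA–H, upgraded by `stub_weightedOfFamilies`).
* `certifiedPairs` — two integrand-`1` representations whose domains are, almost everywhere,
  `ℤ`-combinations of indicators of domains of integrand-`1` representations carrying TORSION
  CERTIFICATES `d • [ρ] ≡ Σ w_j • [box_j]` over Λ-boxes, with equal value, are KZ-equivalent
  (`stub_scissors` + `weightedBoxes` + `stub_torsionClosure` + `stub_pairsOfDecomposition`).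
* `certifiedPairsFintype` — the same over arbitrary finite index types.
* `simplexDecompositionPairs` — the headline instance: two integrand-`1` representations whose
  domains are a.e. signed combinations of Λ-RATIONAL SIMPLICES (binomial cells
  `{x > 0, sa_k < x^{M_k}, ∏ x^{M_k} < sc}`, `det M ≠ 0`, `sc = ∏ sa · α^{su}β^{sv}`; certificates
  by `stub_binomialCertificate`) with equal value are KZ-equivalent. Every finite union of
  polytopes with rational facet normals and offsets in `Λ` (any dimension ≥ 2 of the torus)
  admits such a decomposition (Lawrence–Varchenko signed decomposition into rational simplices),
  so on the rank-two toric polytope sector FORMAL VOLUME DECIDES KZ-EQUIVALENCE as soon as the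
  decomposition is supplied; `stub_cutBoxDecomposition` / `stub_cornerCertificate` supply it for a
  box cut by one wall, `stub_productCertificate` closes the certified class under products,
  `stub_parallelepipedCertificate` adds the pull-backs of boxes under `x ↦ x^M` (`d = |det M|`).

Sources: Kontsevich–Zagier 2001 §1.2 (the moves); Gelfond–Schneider (rank two, via the landed
box sector); Lawrence 1991 / Varchenko 1987 (signed simplex decompositions, used only as the
shape of the hypothesis); folklore.
-/

noncomputable section

open MeasureTheory Set
open Literature.NumberTheory.Transcendental

namespace Summit.KontsevichZagierPeriods.SymplecticScissors.LogPolytope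

/-- **ℤ-weighted Λ-boxes (position form), every dimension `n + 1`** — the landed two-sided box
sector `rankTwoToricBoxesPosition` upgraded to `ℤ`-weighted families by `stub_weightedOfFamilies`
(cells class empty): if finitely many integrand-`1` representations on log-boxes
`{a_j < x_j < a_j·α^{u_j}β^{v_j}}` (real-algebraic position `a`, edge ratios in `α^ℚ β^ℚ`,
required only where the weight is non-zero) have total weighted value `0`, their weighted formal
sum is a relation. [folklore] -/
theorem weightedBoxes :
    ∀ (n : ℕ) (α β : ℝ), 0 < α → 0 < β → IsAlgebraic ℚ α → IsAlgebraic ℚ β →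
      (∀ p q : ℤ, α ^ p * β ^ q = 1 → p = 0 ∧ q = 0) →
      ∀ (k : ℕ) (ρ : Fin k → KZ.IntegralRep (n + 1)) (c : Fin k → ℤ),
      (∀ i, c i ≠ 0 → ∃ (a : Fin n → ℝ) (u v : Fin n → ℚ),
        (∀ p ∈ (ρ i).domain, (ρ i).integrand p = 1) ∧ (∀ j, 0 < a j) ∧
        (∀ j, IsAlgebraic ℚ (a j)) ∧ (∀ j, 1 < α ^ ((u j : ℚ) : ℝ) * β ^ ((v j : ℚ) : ℝ)) ∧
        (ρ i).domain = {p : Fin (n + 1) → ℝ | (∀ j : Fin n, a j < p (Fin.castSucc j) ∧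
          p (Fin.castSucc j) < a j * (α ^ ((u j : ℚ) : ℝ) * β ^ ((v j : ℚ) : ℝ))) ∧
          0 < p (Fin.last n) ∧ p (Fin.last n) * ∏ j : Fin n, p (Fin.castSucc j) < 1}) →
      ∑ i, (c i : ℝ) * (ρ i).value = 0 →
      ∑ i, c i • KZ.of (ρ i) ∈ KZ.relations := by
  intro n α β hα hβ hαa hβa hind k ρ c hG hval
  have h4 := stub_weightedOfFamilies (n + 1)
    (fun σ => ∃ (a : Fin n → ℝ) (u v : Fin n → ℚ),
        (∀ p ∈ σ.domain, σ.integrand p = 1) ∧ (∀ j, 0 < a j) ∧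
        (∀ j, IsAlgebraic ℚ (a j)) ∧ (∀ j, 1 < α ^ ((u j : ℚ) : ℝ) * β ^ ((v j : ℚ) : ℝ)) ∧
        σ.domain = {p : Fin (n + 1) → ℝ | (∀ j : Fin n, a j < p (Fin.castSucc j) ∧
          p (Fin.castSucc j) < a j * (α ^ ((u j : ℚ) : ℝ) * β ^ ((v j : ℚ) : ℝ))) ∧
          0 < p (Fin.last n) ∧ p (Fin.last n) * ∏ j : Fin n, p (Fin.castSucc j) < 1})
    (fun _ => False) ?_ k 0 ρ (fun ν => ν.elim0) c (fun ν => ν.elim0) hG (fun ν => ν.elim0)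
    (by simpa using hval)
  · simpa using h4
  -- the two-sided family property of the box class (cells class empty)
  intro K M K' M' ρB ρS ρB' ρS' hB hS hB' hS' hv
  rcases Nat.eq_zero_or_pos M with rfl | hM
  swap
  · exact (hS ⟨0, hM⟩).elim
  rcases Nat.eq_zero_or_pos M' with rfl | hM'
  swap
  · exact (hS' ⟨0, hM'⟩).elim
  simp only [Finset.univ_eq_empty, Finset.sum_empty, add_zero] at hv ⊢
  choose a u v h1 ha haa hg hdom using hB
  choose a' u' v' h1' ha' haa' hg' hdom' using hB'
  exact toric_rtb_position stub_logBoxCut.1 stub_logBoxLinear.1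
      (toric_rtb_rat (stub_toricAssembly stub_logBoxValue stub_logBoxCut stub_logBoxLinear
        stub_rankTwoLogRatio)) n α β hα hβ hαa hβa hind K K' a u v a' u' v' ρB ρB'
      ha haa hg ha' haa' hg' hdom h1 hdom' h1' hv

/-- **CERTIFIED PAIRS: the rank-two toric sector from signed decompositions, every dimension
`n + 1`.** Two integrand-`1` representations `r`, `r'` whose domains are, almost everywhere,
`ℤ`-combinations of the indicator functions of the domains of integrand-`1` representations
`ρ i` / `ρ' i`, each of which (where its weight is non-zero) carries a TORSION CERTIFICATE
`d • [ρ i] ≡ Σ_j w_j • [σ_j]` over Λ-boxes (position form; `d ≥ 1`), and whose values agree, are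
KZ-equivalent. Composition of `stub_scissors`, `weightedBoxes`, `stub_torsionClosure` and
`stub_pairsOfDecomposition`. Every cell of the line carries such a certificate (boxes: `d = 1`,
themselves; Λ-rational simplices = binomial cells: `d = 1` by `binomialCellToBox`; log-triangles,
parallelepipeds `x ↦ x^M` of boxes: `d = |det M|` by `stub_matrixPowerMove`), so every finite
union of Λ-rational polytopes is covered as soon as a signed decomposition into rational
simplices is supplied (Lawrence–Varchenko; `stub_cornerCut` for a box cut by one wall).
[folklore] -/
theorem certifiedPairs :
    ∀ (n : ℕ) (α β : ℝ), 0 < α → 0 < β → IsAlgebraic ℚ α → IsAlgebraic ℚ β →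
      (∀ p q : ℤ, α ^ p * β ^ q = 1 → p = 0 ∧ q = 0) →
      ∀ (r r' : KZ.IntegralRep (n + 1)) (k k' : ℕ) (ρ : Fin k → KZ.IntegralRep (n + 1))
        (ρ' : Fin k' → KZ.IntegralRep (n + 1)) (c : Fin k → ℤ) (c' : Fin k' → ℤ),
      (∀ p ∈ r.domain, r.integrand p = 1) → (∀ p ∈ r'.domain, r'.integrand p = 1) →
      (∀ i, ∀ p ∈ (ρ i).domain, (ρ i).integrand p = 1) →
      (∀ i, ∀ p ∈ (ρ' i).domain, (ρ' i).integrand p = 1) →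
      (∀ i, c i ≠ 0 → ∃ (d l : ℕ) (σ : Fin l → KZ.IntegralRep (n + 1)) (w : Fin l → ℤ), d ≠ 0 ∧
        (∀ j, w j ≠ 0 → ∃ (a : Fin n → ℝ) (u v : Fin n → ℚ),
          (∀ p ∈ (σ j).domain, (σ j).integrand p = 1) ∧ (∀ ι, 0 < a ι) ∧
          (∀ ι, IsAlgebraic ℚ (a ι)) ∧ (∀ ι, 1 < α ^ ((u ι : ℚ) : ℝ) * β ^ ((v ι : ℚ) : ℝ)) ∧
          (σ j).domain = {p : Fin (n + 1) → ℝ | (∀ ι : Fin n, a ι < p (Fin.castSucc ι) ∧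
            p (Fin.castSucc ι) < a ι * (α ^ ((u ι : ℚ) : ℝ) * β ^ ((v ι : ℚ) : ℝ))) ∧
            0 < p (Fin.last n) ∧ p (Fin.last n) * ∏ ι : Fin n, p (Fin.castSucc ι) < 1}) ∧
        d • KZ.of (ρ i) - ∑ j, w j • KZ.of (σ j) ∈ KZ.relations) →
      (∀ i, c' i ≠ 0 → ∃ (d l : ℕ) (σ : Fin l → KZ.IntegralRep (n + 1)) (w : Fin l → ℤ), d ≠ 0 ∧
        (∀ j, w j ≠ 0 → ∃ (a : Fin n → ℝ) (u v : Fin n → ℚ),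
          (∀ p ∈ (σ j).domain, (σ j).integrand p = 1) ∧ (∀ ι, 0 < a ι) ∧
          (∀ ι, IsAlgebraic ℚ (a ι)) ∧ (∀ ι, 1 < α ^ ((u ι : ℚ) : ℝ) * β ^ ((v ι : ℚ) : ℝ)) ∧
          (σ j).domain = {p : Fin (n + 1) → ℝ | (∀ ι : Fin n, a ι < p (Fin.castSucc ι) ∧
            p (Fin.castSucc ι) < a ι * (α ^ ((u ι : ℚ) : ℝ) * β ^ ((v ι : ℚ) : ℝ))) ∧
            0 < p (Fin.last n) ∧ p (Fin.last n) * ∏ ι : Fin n, p (Fin.castSucc ι) < 1}) ∧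
        d • KZ.of (ρ' i) - ∑ j, w j • KZ.of (σ j) ∈ KZ.relations) →
      (∀ᵐ x : Fin (n + 1) → ℝ, r.domain.indicator (fun _ => (1 : ℝ)) x =
        ∑ i, (c i : ℝ) * (ρ i).domain.indicator (fun _ => (1 : ℝ)) x) →
      (∀ᵐ x : Fin (n + 1) → ℝ, r'.domain.indicator (fun _ => (1 : ℝ)) x =
        ∑ i, (c' i : ℝ) * (ρ' i).domain.indicator (fun _ => (1 : ℝ)) x) →
      r.value = r'.value → KZ.Equivalent r r' := by
  intro n α β hα hβ hαa hβa hind r r' k k' ρ ρ' c c' hr hr' hρ hρ' hc hc' hdec hdec' hval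
  -- the ℤ-weighted property of the certified class (torsion closure of the box class)
  have hW1 := stub_torsionClosure (n + 1)
    (fun σ => ∃ (a : Fin n → ℝ) (u v : Fin n → ℚ),
        (∀ p ∈ σ.domain, σ.integrand p = 1) ∧ (∀ ι, 0 < a ι) ∧
        (∀ ι, IsAlgebraic ℚ (a ι)) ∧ (∀ ι, 1 < α ^ ((u ι : ℚ) : ℝ) * β ^ ((v ι : ℚ) : ℝ)) ∧
        σ.domain = {p : Fin (n + 1) → ℝ | (∀ ι : Fin n, a ι < p (Fin.castSucc ι) ∧
          p (Fin.castSucc ι) < a ι * (α ^ ((u ι : ℚ) : ℝ) * β ^ ((v ι : ℚ) : ℝ))) ∧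
          0 < p (Fin.last n) ∧ p (Fin.last n) * ∏ ι : Fin n, p (Fin.castSucc ι) < 1})
    (fun K σ w hw hv => weightedBoxes n α β hα hβ hαa hβa hind K σ w hw hv)
  refine stub_pairsOfDecomposition (n + 1)
    (fun τ => ∃ (d l : ℕ) (σ : Fin l → KZ.IntegralRep (n + 1)) (w : Fin l → ℤ), d ≠ 0 ∧
        (∀ j, w j ≠ 0 → ∃ (a : Fin n → ℝ) (u v : Fin n → ℚ),
          (∀ p ∈ (σ j).domain, (σ j).integrand p = 1) ∧ (∀ ι, 0 < a ι) ∧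
          (∀ ι, IsAlgebraic ℚ (a ι)) ∧ (∀ ι, 1 < α ^ ((u ι : ℚ) : ℝ) * β ^ ((v ι : ℚ) : ℝ)) ∧
          (σ j).domain = {p : Fin (n + 1) → ℝ | (∀ ι : Fin n, a ι < p (Fin.castSucc ι) ∧
            p (Fin.castSucc ι) < a ι * (α ^ ((u ι : ℚ) : ℝ) * β ^ ((v ι : ℚ) : ℝ))) ∧
            0 < p (Fin.last n) ∧ p (Fin.last n) * ∏ ι : Fin n, p (Fin.castSucc ι) < 1}) ∧
        d • KZ.of τ - ∑ j, w j • KZ.of (σ j) ∈ KZ.relations)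
    (fun _ => False) (stub_scissors (n + 1)) ?_
    r r' k 0 k' 0 ρ (fun ν => ν.elim0) ρ' (fun ν => ν.elim0) c (fun ν => ν.elim0)
    c' (fun ν => ν.elim0) hr hr' hρ (fun ν => ν.elim0) hρ' (fun ν => ν.elim0) hc
    (fun ν => ν.elim0) hc' (fun ν => ν.elim0) (by simpa using hdec) (by simpa using hdec') hval
  -- the two-class weighted property (cells class empty: its weights vanish)
  intro K M ρB ρS cB cS hB hS hv
  have hcS : ∀ ν, cS ν = 0 := fun ν => by_contra fun h => hS ν h
  simp only [hcS, Int.cast_zero, zero_mul, Finset.sum_const_zero, add_zero, zero_smul] at hv ⊢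
  exact hW1 K ρB cB hB hv


/-- **Certified pairs over arbitrary finite index types** (transport of `certifiedPairs` along
`Fintype.equivFin`). [folklore] -/
theorem certifiedPairsFintype :
    ∀ (n : ℕ) (α β : ℝ), 0 < α → 0 < β → IsAlgebraic ℚ α → IsAlgebraic ℚ β →
      (∀ p q : ℤ, α ^ p * β ^ q = 1 → p = 0 ∧ q = 0) →
      ∀ (ι ι' : Type) [Fintype ι] [Fintype ι'] (r r' : KZ.IntegralRep (n + 1))
        (ρ : ι → KZ.IntegralRep (n + 1)) (ρ' : ι' → KZ.IntegralRep (n + 1)) (c : ι → ℤ) (c' : ι' → ℤ),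
      (∀ p ∈ r.domain, r.integrand p = 1) → (∀ p ∈ r'.domain, r'.integrand p = 1) →
      (∀ i, ∀ p ∈ (ρ i).domain, (ρ i).integrand p = 1) →
      (∀ i, ∀ p ∈ (ρ' i).domain, (ρ' i).integrand p = 1) →
      (∀ i, c i ≠ 0 → ∃ (d l : ℕ) (σ : Fin l → KZ.IntegralRep (n + 1)) (w : Fin l → ℤ), d ≠ 0 ∧
        (∀ j, w j ≠ 0 → ∃ (a : Fin (n) → ℝ) (u v : Fin (n) → ℚ),
          (∀ ξ ∈ (σ j).domain, (σ j).integrand ξ = 1) ∧ (∀ ι, 0 < a ι) ∧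
          (∀ ι, IsAlgebraic ℚ (a ι)) ∧ (∀ ι, 1 < α ^ ((u ι : ℚ) : ℝ) * β ^ ((v ι : ℚ) : ℝ)) ∧
          (σ j).domain = {ξ : Fin (n + 1) → ℝ | (∀ ι : Fin (n), a ι < ξ (Fin.castSucc ι) ∧
            ξ (Fin.castSucc ι) < a ι * (α ^ ((u ι : ℚ) : ℝ) * β ^ ((v ι : ℚ) : ℝ))) ∧
            0 < ξ (Fin.last (n)) ∧ ξ (Fin.last (n)) * ∏ ι : Fin (n), ξ (Fin.castSucc ι) < 1}) ∧
        d • KZ.of (ρ i) - ∑ j, w j • KZ.of (σ j) ∈ KZ.relations) →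
      (∀ i, c' i ≠ 0 → ∃ (d l : ℕ) (σ : Fin l → KZ.IntegralRep (n + 1)) (w : Fin l → ℤ), d ≠ 0 ∧
        (∀ j, w j ≠ 0 → ∃ (a : Fin (n) → ℝ) (u v : Fin (n) → ℚ),
          (∀ ξ ∈ (σ j).domain, (σ j).integrand ξ = 1) ∧ (∀ ι, 0 < a ι) ∧
          (∀ ι, IsAlgebraic ℚ (a ι)) ∧ (∀ ι, 1 < α ^ ((u ι : ℚ) : ℝ) * β ^ ((v ι : ℚ) : ℝ)) ∧
          (σ j).domain = {ξ : Fin (n + 1) → ℝ | (∀ ι : Fin (n), a ι < ξ (Fin.castSucc ι) ∧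
            ξ (Fin.castSucc ι) < a ι * (α ^ ((u ι : ℚ) : ℝ) * β ^ ((v ι : ℚ) : ℝ))) ∧
            0 < ξ (Fin.last (n)) ∧ ξ (Fin.last (n)) * ∏ ι : Fin (n), ξ (Fin.castSucc ι) < 1}) ∧
        d • KZ.of (ρ' i) - ∑ j, w j • KZ.of (σ j) ∈ KZ.relations) →
      (∀ᵐ x : Fin (n + 1) → ℝ, r.domain.indicator (fun _ => (1 : ℝ)) x =
        ∑ i, (c i : ℝ) * (ρ i).domain.indicator (fun _ => (1 : ℝ)) x) →
      (∀ᵐ x : Fin (n + 1) → ℝ, r'.domain.indicator (fun _ => (1 : ℝ)) x =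
        ∑ i, (c' i : ℝ) * (ρ' i).domain.indicator (fun _ => (1 : ℝ)) x) →
      r.value = r'.value → KZ.Equivalent r r' := by
  intro n α β hα hβ hαa hβa hind ι ι' _ _ r r' ρ ρ' c c' hr hr' hρ hρ' hc hc' hdec hdec' hval
  classical
  set e := Fintype.equivFin ι with he
  set e' := Fintype.equivFin ι' with he'
  refine certifiedPairs n α β hα hβ hαa hβa hind r r' (Fintype.card ι) (Fintype.card ι')
    (fun i => ρ (e.symm i)) (fun i => ρ' (e'.symm i)) (fun i => c (e.symm i)) (fun i => c' (e'.symm i))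
    hr hr' (fun i => hρ (e.symm i)) (fun i => hρ' (e'.symm i)) (fun i hi => hc (e.symm i) hi)
    (fun i hi => hc' (e'.symm i) hi) ?_ ?_ hval
  · filter_upwards [hdec] with x hx
    rw [hx]
    exact (e.symm.sum_comp (fun i => (c i : ℝ) * (ρ i).domain.indicator (fun _ => (1 : ℝ)) x)).symm
  · filter_upwards [hdec'] with x hx
    rw [hx]
    exact (e'.symm.sum_comp (fun i => (c' i : ℝ) * (ρ' i).domain.indicator (fun _ => (1 : ℝ)) x)).symm

/-- **SIMPLEX-DECOMPOSITION PAIRS (headline form of the rank-two toric sector).** Two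
integrand-`1` representations of dimension `n + 2` whose domains are, almost everywhere,
`ℤ`-combinations of indicators of Λ-rational simplices — binomial cells
`{x > 0, sa_k < x^{M_k}, ∏_k x^{M_k} < sc}` with `det M ≠ 0`, `sa` positive real algebraic,
`sc = ∏ sa · α^{su} β^{sv}` and (where the weight is non-zero) `α^{su} β^{sv} > 1` — and whose
values agree are KZ-equivalent: `certifiedPairs` fed with `stub_binomialCertificate`. In
logarithmic coordinates these cells are exactly the simplices with rational facet normals and
vertices over `Λ = ℚ log α ⊕ ℚ log β`; every finite union of Λ-rational polytopes is an a.e.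
signed combination of them (Lawrence–Varchenko), so formal volume decides KZ-equivalence on the
whole rank-two toric polytope sector once such a decomposition is written down. [folklore] -/
theorem simplexDecompositionPairs :
    ∀ (n : ℕ) (α β : ℝ), 0 < α → 0 < β → IsAlgebraic ℚ α → IsAlgebraic ℚ β →
      (∀ p q : ℤ, α ^ p * β ^ q = 1 → p = 0 ∧ q = 0) →
      ∀ (r r' : KZ.IntegralRep (n + 1 + 1)) (m m' : ℕ)
        (sM : Fin m → Matrix (Fin (n + 1)) (Fin (n + 1)) ℤ) (sa : Fin m → Fin (n + 1) → ℝ)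
        (sc : Fin m → ℝ) (su sv : Fin m → ℚ)
        (sM' : Fin m' → Matrix (Fin (n + 1)) (Fin (n + 1)) ℤ) (sa' : Fin m' → Fin (n + 1) → ℝ)
        (sc' : Fin m' → ℝ) (su' sv' : Fin m' → ℚ)
        (ρ : Fin m → KZ.IntegralRep (n + 1 + 1)) (ρ' : Fin m' → KZ.IntegralRep (n + 1 + 1))
        (c : Fin m → ℤ) (c' : Fin m' → ℤ),
      (∀ ν, (sM ν).det ≠ 0) → (∀ ν ι, 0 < sa ν ι) → (∀ ν ι, IsAlgebraic ℚ (sa ν ι)) →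
      (∀ ν, IsAlgebraic ℚ (sc ν)) →
      (∀ ν, sc ν = (∏ ι, sa ν ι) * (α ^ ((su ν : ℚ) : ℝ) * β ^ ((sv ν : ℚ) : ℝ))) →
      (∀ ν, c ν ≠ 0 → 1 < α ^ ((su ν : ℚ) : ℝ) * β ^ ((sv ν : ℚ) : ℝ)) →
      (∀ ν, (ρ ν).domain = {p : Fin (n + 1 + 1) → ℝ | (∀ ι : Fin (n + 1), 0 < p (Fin.castSucc ι)) ∧
        (∀ k : Fin (n + 1), sa ν k < ∏ j : Fin (n + 1), p (Fin.castSucc j) ^ (sM ν k j)) ∧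
        ∏ k : Fin (n + 1), ∏ j : Fin (n + 1), p (Fin.castSucc j) ^ (sM ν k j) < sc ν ∧
        0 < p (Fin.last (n + 1)) ∧ p (Fin.last (n + 1)) * ∏ ι : Fin (n + 1), p (Fin.castSucc ι) < 1}) →
      (∀ ν, ∀ p ∈ (ρ ν).domain, (ρ ν).integrand p = 1) →
      (∀ ν, (sM' ν).det ≠ 0) → (∀ ν ι, 0 < sa' ν ι) → (∀ ν ι, IsAlgebraic ℚ (sa' ν ι)) →
      (∀ ν, IsAlgebraic ℚ (sc' ν)) →
      (∀ ν, sc' ν = (∏ ι, sa' ν ι) * (α ^ ((su' ν : ℚ) : ℝ) * β ^ ((sv' ν : ℚ) : ℝ))) →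
      (∀ ν, c' ν ≠ 0 → 1 < α ^ ((su' ν : ℚ) : ℝ) * β ^ ((sv' ν : ℚ) : ℝ)) →
      (∀ ν, (ρ' ν).domain = {p : Fin (n + 1 + 1) → ℝ | (∀ ι : Fin (n + 1), 0 < p (Fin.castSucc ι)) ∧
        (∀ k : Fin (n + 1), sa' ν k < ∏ j : Fin (n + 1), p (Fin.castSucc j) ^ (sM' ν k j)) ∧
        ∏ k : Fin (n + 1), ∏ j : Fin (n + 1), p (Fin.castSucc j) ^ (sM' ν k j) < sc' ν ∧
        0 < p (Fin.last (n + 1)) ∧ p (Fin.last (n + 1)) * ∏ ι : Fin (n + 1), p (Fin.castSucc ι) < 1}) →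
      (∀ ν, ∀ p ∈ (ρ' ν).domain, (ρ' ν).integrand p = 1) →
      (∀ p ∈ r.domain, r.integrand p = 1) → (∀ p ∈ r'.domain, r'.integrand p = 1) →
      (∀ᵐ x : Fin (n + 1 + 1) → ℝ, r.domain.indicator (fun _ => (1 : ℝ)) x =
        ∑ ν, (c ν : ℝ) * (ρ ν).domain.indicator (fun _ => (1 : ℝ)) x) →
      (∀ᵐ x : Fin (n + 1 + 1) → ℝ, r'.domain.indicator (fun _ => (1 : ℝ)) x =
        ∑ ν, (c' ν : ℝ) * (ρ' ν).domain.indicator (fun _ => (1 : ℝ)) x) →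
      r.value = r'.value → KZ.Equivalent r r' := by
  intro n α β hα hβ hαa hβa hind r r' m m' sM sa sc su sv sM' sa' sc' su' sv' ρ ρ' c c'
    hdet hsa hsaa hsca hsc hg hdom hρ hdet' hsa' hsaa' hsca' hsc' hg' hdom' hρ' hr hr' hdec hdec' hval
  exact certifiedPairs (n + 1) α β hα hβ hαa hβa hind r r' m m' ρ ρ' c c' hr hr' hρ hρ'
    (fun ν hν => stub_binomialCertificate n α β hα hβ hαa hβa (sM ν) (sa ν) (sc ν) (su ν) (sv ν)
      (ρ ν) (hdet ν) (hsa ν) (hsaa ν) (hsca ν) (hsc ν) (hg ν hν) (hdom ν) (hρ ν))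
    (fun ν hν => stub_binomialCertificate n α β hα hβ hαa hβa (sM' ν) (sa' ν) (sc' ν) (su' ν) (sv' ν)
      (ρ' ν) (hdet' ν) (hsa' ν) (hsaa' ν) (hsca' ν) (hsc' ν) (hg' ν hν) (hdom' ν) (hρ' ν))
    hdec hdec' hval

end Summit.KontsevichZagierPeriods.SymplecticScissors.LogPolytope

end
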